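import Mathlib
import Literature.NumberTheory.LFunctions.RiemannXi
import Literature.NumberTheory.LFunctions.RiemannXiProofs
import Summits.RiemannHypothesis.RiemannHypothesis.Theses.RuelleBand
import Summits.RiemannHypothesis.RiemannHypothesis.Cruxes.CofiniteCriticalLine.Disproof

/-!
# Sketch — crux idea `rate-band-collar-split` for `RuelleBand.CofiniteCriticalLine`

First-lemma signatures only (crux-ideate stage; no proofs required, everything must elaborate).
-/

namespace Summit.RiemannHypothesis.RiemannHypothesis.Cruxes.CofiniteCriticalLine.RateBandCollarSplit

open Literature.NumberTheory.LFunctions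
open Summit.RiemannHypothesis.RiemannHypothesis.Theses.RuelleBand

/-- FAR regime ("band with a rate"): every non-trivial zero of height `|Im s| ≥ T₁` lies within
`C |Im s| ^ (-ε)` of the critical line.  For `ε = 0` and `C = ε'` this is the eventual form of
`AsymptoticCriticalLine`; a polynomial rate `ε > 0` is the natural quantitative output of a
Faure–Tsujii band theorem (remainders `O(ω^{-β/2})` in the frequency `ω = Im z`). RH-implied. -/
def RateBand (ε C T₁ : ℝ) : Prop :=
  ∀ s : ℂ, riemannZeta s = 0 → 0 < s.re → s.re < 1 → T₁ ≤ |s.im| →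
    |s.re - 1 / 2| ≤ C * |s.im| ^ (-ε)

/-- NEAR regime ("collar monotonicity"): for `|t| ≥ T₂` the modulus `x ↦ |ξ(1/2 + x + it)|` is
nondecreasing on the collar `0 ≤ x ≤ C |t| ^ (-ε)`.  Cofinite Sondow–Dumitrescu /
Matiyasevich–Saidak–Zvengrowski restricted to a polynomially thin collar; RH-implied
(`ξ ∈ LP ⇒ |ξ(1/2+x+it)|² = Σ L_n(t) x^{2n}` with all `L_n ≥ 0`, Csordas 2015 (2.11)). -/
def CollarMono (ε C T₂ : ℝ) : Prop :=
  ∀ t : ℝ, T₂ ≤ |t| →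
    MonotoneOn (fun x : ℝ => ‖riemannXi (1 / 2 + x + t * Complex.I)‖) (Set.Icc 0 (C * |t| ^ (-ε)))

/-- Zeros of bounded height are finitely many (isolated zeros of the entire `ξ` in a compact
rectangle; provable now). -/
def BoundedHeightFinite : Prop :=
  ∀ T : ℝ, {s : ℂ | riemannZeta s = 0 ∧ 0 < s.re ∧ s.re < 1 ∧ |s.im| ≤ T}.Finite

/-- FIRST LEMMA (composition, provable now, elementary): a polynomial-rate band together with
collar monotonicity at the SAME rate gives the crux.  Proof sketch: an off-line zero `ρ₀ = β₀ + iγ₀`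
with `|γ₀| ≥ max T₁ T₂` has `0 < |β₀ - 1/2| ≤ C|γ₀|^{-ε}` (RateBand; use `ρ₀` or `1 - conj ρ₀` to get
`β₀ > 1/2`), so `x ↦ |ξ(1/2 + x + iγ₀)|` is nondecreasing on `[0, C|γ₀|^{-ε}] ∋ β₀ - 1/2` and
vanishes at `x = β₀ - 1/2`, hence vanishes on `[0, β₀ - 1/2]`; `ξ` entire and not identically zero
(`riemannXi 0 = 1/2`) contradicts the identity theorem.  So all off-line zeros have height
`< max T₁ T₂`, and `BoundedHeightFinite` finishes. -/
def FirstLemma : Prop :=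
  ∀ ε C T₁ T₂ : ℝ, RateBand ε C T₁ → CollarMono ε C T₂ → CofiniteCriticalLine

/-- EXACTNESS of the split (provable now modulo the Hadamard product for `ξ'/ξ`, in tree as
`RiemannXiHadamardProduct` / `ZetaLogDerivRePartialFraction`): the crux implies both halves for
every rate, so nothing is lost by splitting. -/
def SplitExact : Prop :=
  CofiniteCriticalLine → ∀ ε C : ℝ, 0 < C → ∃ T : ℝ, RateBand ε C T ∧ CollarMono ε C T

/-- The collar half in Laguerre form (Csordas 2015, (2.7)/(2.11)): with
`Ξ(z) = ξ(1/2 + i z)` and `L_n(t)` the generalized real Laguerre expressions of `Ξ`,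
`|ξ(1/2 + x + it)|² = |Ξ(t + i x)|²`-type expansion `= Σ_n L_n(t) x^{2n}`; a quantitative eventual
first Laguerre inequality dominating the tail on the collar implies `CollarMono`.  Stated here as
the crude sufficient condition "every even `x`-derivative of `|ξ(1/2+x+it)|²` at `x = 0` is
nonnegative for `|t| ≥ T₂`" (eventual form of Csordas–Varga's RH criterion, all `n`). -/
def EventualLaguerreAllOrders (T₂ : ℝ) : Prop :=
  ∀ t : ℝ, T₂ ≤ |t| → ∀ n : ℕ,
    0 ≤ iteratedDeriv (2 * n) (fun x : ℝ => ‖riemannXi (1 / 2 + x + t * Complex.I)‖ ^ 2) 0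

/-- The analytic core of the composition, isolated: rate + collar ⇒ "RH above some height".
(Its proof is the identity-theorem argument in the docstring of `FirstLemma`; left to crux-plan.) -/
def EventualCore : Prop :=
  ∀ ε C T₁ T₂ : ℝ, RateBand ε C T₁ → CollarMono ε C T₂ →
    ∃ T : ℝ, ∀ s : ℂ, riemannZeta s = 0 → 0 < s.re → s.re < 1 → T < |s.im| → s.re = 1 / 2

/-- GLUE (sorry-free): the bounded-height step is exactly the standing disprover's theorem
`Disproof.cofiniteCriticalLine_iff_eventually_on_line` (crux ⟺ RH above some height; Mathlib
`IsCompact.inter_riemannZetaZeros_finite`), so `FirstLemma` reduces to `EventualCore`. -/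
theorem firstLemma_of_eventualCore (h : EventualCore) : FirstLemma :=
  fun ε C T₁ T₂ h₁ h₂ =>
    (Disproof.cofiniteCriticalLine_iff_eventually_on_line).2 (h ε C T₁ T₂ h₁ h₂)

/-- The analytic core, PROVED (elementary: rate puts the zero in the collar, collar monotonicity makes
`|ξ|` vanish on a segment, isolated zeros of the entire `ξ` + `ξ 0 = 1/2` give the contradiction). -/
theorem eventualCore_holds : EventualCore := by
  intro ε C T₁ T₂ hR hC
  -- zeros strictly RIGHT of the line above height max T₁ T₂ are impossible
  have key : ∀ w : ℂ, riemannZeta w = 0 → 1 / 2 < w.re → w.re < 1 → max T₁ T₂ < |w.im| → False := by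
    intro w hw hgt hlt hwT
    have hT₁ : T₁ ≤ |w.im| := le_trans (le_max_left _ _) hwT.le
    have hT₂ : T₂ ≤ |w.im| := le_trans (le_max_right _ _) hwT.le
    have hrate : |w.re - 1 / 2| ≤ C * |w.im| ^ (-ε) := hR w hw (by linarith) hlt hT₁
    set x₀ : ℝ := w.re - 1 / 2 with hx₀
    have hx₀pos : 0 < x₀ := by rw [hx₀]; linarith
    have hx₀le : x₀ ≤ C * |w.im| ^ (-ε) := by
      have habs : |w.re - 1 / 2| = x₀ := by rw [hx₀]; exact abs_of_pos (by linarith)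
      linarith [habs ▸ hrate]
    have hmono := hC w.im hT₂
    have hw_eq : (1 / 2 : ℂ) + ((x₀ : ℝ) : ℂ) + ((w.im : ℝ) : ℂ) * Complex.I = w := by
      apply Complex.ext
      · simp [hx₀]
      · simp
    have hξw : riemannXi w = 0 := (riemannXi_eq_zero_iff_holds w).2 ⟨hw, by linarith, hlt⟩
    have hf0 : ‖riemannXi (1 / 2 + ((x₀ : ℝ) : ℂ) + ((w.im : ℝ) : ℂ) * Complex.I)‖ = 0 := by
      rw [hw_eq, hξw, norm_zero]
    -- every point of the segment [1/2, 1/2 + x₀] + i·im w is a zero of ξ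
    have hzero : ∀ x : ℝ, 0 ≤ x → x ≤ x₀ →
        riemannXi (1 / 2 + ((x : ℝ) : ℂ) + ((w.im : ℝ) : ℂ) * Complex.I) = 0 := by
      intro x hx hxx
      have hxmem : x ∈ Set.Icc 0 (C * |w.im| ^ (-ε)) := ⟨hx, le_trans hxx hx₀le⟩
      have hx₀mem : x₀ ∈ Set.Icc 0 (C * |w.im| ^ (-ε)) := ⟨hx₀pos.le, hx₀le⟩
      have hle : ‖riemannXi (1 / 2 + ((x : ℝ) : ℂ) + ((w.im : ℝ) : ℂ) * Complex.I)‖ ≤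
          ‖riemannXi (1 / 2 + ((x₀ : ℝ) : ℂ) + ((w.im : ℝ) : ℂ) * Complex.I)‖ := hmono hxmem hx₀mem hxx
      rw [hf0] at hle
      exact norm_eq_zero.1 (le_antisymm hle (norm_nonneg _))
    -- isolated zeros of the entire function ξ at w
    have han : AnalyticAt ℂ riemannXi w := differentiable_riemannXi.analyticAt w
    rcases han.eventually_eq_zero_or_eventually_ne_zero with hev | hev
    · have hall : Set.EqOn riemannXi 0 Set.univ :=
        AnalyticOnNhd.eqOn_zero_of_preconnected_of_eventuallyEq_zero
          (fun z _ => differentiable_riemannXi.analyticAt z) isPreconnected_univ (Set.mem_univ w) hev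
      have h00 := hall (Set.mem_univ (0 : ℂ))
      rw [riemannXi_zero] at h00
      norm_num at h00
    · rw [eventually_nhdsWithin_iff, Metric.eventually_nhds_iff] at hev
      obtain ⟨δ, hδ, hδ'⟩ := hev
      set m : ℝ := min (δ / 2) x₀ with hm
      have hmpos : 0 < m := lt_min (by linarith) hx₀pos
      have hmle : m ≤ x₀ := min_le_right _ _
      have hmle' : m ≤ δ / 2 := min_le_left _ _
      have hz' := hzero (x₀ - m) (by linarith) (by linarith)
      have hzpt : (1 / 2 : ℂ) + (((x₀ - m : ℝ)) : ℂ) + ((w.im : ℝ) : ℂ) * Complex.I = w - (m : ℂ) := by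
        apply Complex.ext
        · simp [hx₀]; ring
        · simp
      have hdist : dist ((1 / 2 : ℂ) + (((x₀ - m : ℝ)) : ℂ) + ((w.im : ℝ) : ℂ) * Complex.I) w < δ := by
        rw [hzpt, dist_eq_norm, sub_sub_cancel_left, norm_neg, Complex.norm_real, Real.norm_eq_abs,
          abs_of_pos hmpos]
        linarith
      have hne' : (1 / 2 : ℂ) + (((x₀ - m : ℝ)) : ℂ) + ((w.im : ℝ) : ℂ) * Complex.I ∈ ({w}ᶜ : Set ℂ) := by
        rw [Set.mem_compl_singleton_iff, hzpt, Ne, sub_eq_self]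
        exact_mod_cast hmpos.ne'
      exact hδ' hdist hne' hz'
  refine ⟨max T₁ T₂, fun s hz h0 h1 hT => ?_⟩
  by_contra hne
  rcases lt_or_gt_of_ne hne with hlt | hgt
  · -- zero LEFT of the line: reflect by the functional equation s ↦ 1 - s
    refine key (1 - s) (GeneralizedRH.riemannZeta_one_sub_eq_zero hz h0 h1) ?_ ?_ ?_
    · simp only [Complex.sub_re, Complex.one_re]; linarith
    · simp only [Complex.sub_re, Complex.one_re]; linarith
    · simpa [Complex.sub_im, Complex.one_im, abs_neg] using hT
  · exact key s hz hgt h1 hT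

/-- Hence the FIRST LEMMA is a theorem (sorry-free): rate + collar ⇒ the crux. -/
theorem firstLemma_holds : FirstLemma := firstLemma_of_eventualCore eventualCore_holds

/-- The CONSTANT-rate member of the family: eventual monotonicity of `|ξ|` across a collar of FIXED
width `ε₀` (RH-implied; strictly weaker than the crux). -/
def FixedCollarMono (ε₀ T : ℝ) : Prop :=
  ∀ t : ℝ, T ≤ |t| →
    MonotoneOn (fun x : ℝ => ‖riemannXi (1 / 2 + x + t * Complex.I)‖) (Set.Icc 0 ε₀)

/-- `#5 ∖ #4` MADE EXPLICIT (proved): the route's rung #4 `AsymptoticCriticalLine`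
(stmt-RiemannHypothesis-2063) at ONE width `ε₀ > 0`, plus fixed-width collar monotonicity at the same
width, gives the crux.  So the residual content of rung #5 over rung #4 is exactly an eventual
horizontal-monotonicity statement for `|ξ|` on a fixed collar of the critical line. -/
theorem cofinite_of_asymptotic_of_fixedCollarMono {ε₀ T : ℝ} (hε₀ : 0 < ε₀)
    (h4 : AsymptoticCriticalLine) (hc : FixedCollarMono ε₀ T) : CofiniteCriticalLine := by
  -- heights of the finitely many zeros at distance ≥ ε₀ from the line are bounded
  obtain ⟨M, hM⟩ := ((h4 ε₀ hε₀).image fun s : ℂ => |s.im|).bddAbove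
  have hR : RateBand 0 ε₀ (M + 1) := by
    intro s hz h0 h1 hT
    rw [neg_zero, Real.rpow_zero, mul_one]
    by_contra hlt
    have hmem : |s.im| ∈ (fun s : ℂ => |s.im|) '' {s : ℂ | riemannZeta s = 0 ∧ 0 < s.re ∧ s.re < 1 ∧
        ε₀ ≤ |s.re - 1 / 2|} := ⟨s, ⟨hz, h0, h1, not_le.1 hlt |>.le⟩, rfl⟩
    have := hM hmem
    linarith
  have hC : CollarMono 0 ε₀ T := by
    intro t ht
    rw [neg_zero, Real.rpow_zero, mul_one]
    exact hc t ht
  exact firstLemma_holds 0 ε₀ (M + 1) T hR hC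

/-- Sanity: composition shape. -/
theorem firstLemma_shape : FirstLemma →
    ∀ ε C T₁ T₂ : ℝ, RateBand ε C T₁ → CollarMono ε C T₂ → CofiniteCriticalLine :=
  fun h ε C T₁ T₂ h₁ h₂ => h ε C T₁ T₂ h₁ h₂

end Summit.RiemannHypothesis.RiemannHypothesis.Cruxes.CofiniteCriticalLine.RateBandCollarSplit
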